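import Literature.MathematicalPhysics.KineticTheory.HardSphereWindowPressureStatic
import Literature.MathematicalPhysics.KineticTheory.HardSphereTwoTimePressure
import Literature.MathematicalPhysics.KineticTheory.CollisionWindowBookkeeping
import HarnessLib

/-!
# Binned, clamped collision-jump payloads, I: statics (binning, binary collisions, budgets,
# pressure domination)

Topic `Literature/MathematicalPhysics/KineticTheory`.  In coarse collision filtrations (Kipnis–Landim
1999 App. 1 §5–6 paradigm: Dynkin martingales of jump functionals along a Markovian coarse-graining)
the jump payload `φ(xᵢ)·(g(vᵢ⁺) - g(vᵢ⁻))` of a particle at a collision is recorded through BINNED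
marks `r⌊·/r⌋` (meshes `rφ` for `φ`, `rg` for `g`), each particle being CLAMPED at its `K`-th
collision of the window.  This file collects the static inputs showing that the resulting process is a
free term of window-pressure estimates (the pathwise telescoping is in `HardSphereJumpTelescoping` and
`HardSphereBinnedJumpPayload`):

* binning: `abs_mul_floor_div_sub_le`, `abs_mul_floor_div_le`, `measurable_mul_floor_div`, and the
  per-jump binning error `abs_binned_sub_exact_le` (`≤ 2rφ(b+rg) + 2rg` for `|φ| ≤ 1`, `|g| ≤ b`);
* binary collisions: `abs_sum_ite_participates_and_le` — a sum of contributions of (some of) the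
  participants at a time has at most two terms (`sum_ite_participates_le_two`);
* threshold arithmetic for the deterministic budget (`natCeil_add_one_div_le`,
  `clampedJump_deterministic_budget_le`, `hsDiameter_lt_half_of_ne_zero`);
* **pressure domination** `lintegral_exp_le_of_le_windowAvg_sum_localGibbsLaw_const`: an observable
  bounded on the good set by `α +` the window average of a one-body `Σᵢ q` has
  `∫⁻ exp ≤ exp(α) C^{N+1}` under the flow-invariant homogeneous Gibbs law
  (`lintegral_exp_windowAvg_sum_localGibbsLaw_const_le` of `HardSphereWindowPressureStatic`).

No new definitions.

## References

* C. Kipnis, C. Landim, *Scaling Limits of Interacting Particle Systems* (1999), App. 1 §5–6.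
* I. Gallagher, L. Saint-Raymond, B. Texier, *From Newton to Boltzmann* (2013), §4.1.
-/

noncomputable section

namespace Literature.MathematicalPhysics.KineticTheory

open _root_.MeasureTheory Set Filter Function
open scoped ENNReal BigOperators
open Literature.Analysis.FluidPDE

/-! ### Binning a real at a mesh -/

/-- Binning moves a value by at most the mesh: `|r⌊x/r⌋ - x| ≤ r` (`r > 0`). [folklore] -/
theorem abs_mul_floor_div_sub_le {r : ℝ} (hr : 0 < r) (x : ℝ) :
    |r * ((⌊x / r⌋ : ℤ) : ℝ) - x| ≤ r := by
  have h1 : ((⌊x / r⌋ : ℤ) : ℝ) ≤ x / r := Int.floor_le _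
  have h2 : x / r < ((⌊x / r⌋ : ℤ) : ℝ) + 1 := Int.lt_floor_add_one _
  have h3 : r * ((⌊x / r⌋ : ℤ) : ℝ) ≤ x := by
    have := mul_le_mul_of_nonneg_left h1 hr.le
    rwa [mul_div_cancel₀ _ hr.ne'] at this
  have h4 : x - r < r * ((⌊x / r⌋ : ℤ) : ℝ) := by
    have := mul_lt_mul_of_pos_left h2 hr
    rw [mul_add, mul_one, mul_div_cancel₀ _ hr.ne'] at this
    linarith
  rw [abs_le]
  constructor <;> linarith

/-- A binned value exceeds the bound of the value by at most the mesh. [folklore] -/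
theorem abs_mul_floor_div_le {r : ℝ} (hr : 0 < r) {x M : ℝ} (hx : |x| ≤ M) :
    |r * ((⌊x / r⌋ : ℤ) : ℝ)| ≤ M + r := by
  have h := abs_mul_floor_div_sub_le hr x
  calc |r * ((⌊x / r⌋ : ℤ) : ℝ)| = |(r * ((⌊x / r⌋ : ℤ) : ℝ) - x) + x| := by ring_nf
    _ ≤ |r * ((⌊x / r⌋ : ℤ) : ℝ) - x| + |x| := abs_add_le _ _
    _ ≤ r + M := add_le_add h hx
    _ = M + r := add_comm _ _

/-- Binning is measurable. [folklore] -/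
theorem measurable_mul_floor_div (r : ℝ) : Measurable fun x : ℝ => r * ((⌊x / r⌋ : ℤ) : ℝ) :=
  measurable_const.mul ((measurable_from_top (f := fun n : ℤ => (n : ℝ))).comp
    (Int.measurable_floor.comp (measurable_id.div_const r)))

/-- **Binning error of one jump payload**: for `|φ| ≤ 1`, `|φ̃ - φ| ≤ δφ`, `|s̃|, |r̃| ≤ b + δ₀`,
`|s̃ - s|, |r̃ - r| ≤ δ₀`: `|φ̃ (s̃ - r̃) - φ (s - r)| ≤ 2δφ(b + δ₀) + 2δ₀`. [folklore] -/
theorem abs_binned_sub_exact_le {φ φ' s s' r r' δφ δ₀ b : ℝ} (hφ : |φ| ≤ 1) (hφ' : |φ' - φ| ≤ δφ)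
    (hs' : |s'| ≤ b + δ₀) (hr' : |r'| ≤ b + δ₀) (hs : |s' - s| ≤ δ₀) (hr : |r' - r| ≤ δ₀) :
    |φ' * (s' - r') - φ * (s - r)| ≤ 2 * δφ * (b + δ₀) + 2 * δ₀ := by
  have hδφ : 0 ≤ δφ := (abs_nonneg _).trans hφ'
  have h1 : |(φ' - φ) * (s' - r')| ≤ δφ * (2 * (b + δ₀)) := by
    rw [abs_mul]
    exact mul_le_mul hφ' ((abs_sub _ _).trans (by linarith)) (abs_nonneg _) hδφ
  have h2 : |φ * ((s' - s) - (r' - r))| ≤ 1 * (δ₀ + δ₀) := by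
    rw [abs_mul]
    exact mul_le_mul hφ ((abs_sub _ _).trans (add_le_add hs hr)) (abs_nonneg _) zero_le_one
  calc |φ' * (s' - r') - φ * (s - r)| = |(φ' - φ) * (s' - r') + φ * ((s' - s) - (r' - r))| := by
        ring_nf
    _ ≤ |(φ' - φ) * (s' - r')| + |φ * ((s' - s) - (r' - r))| := abs_add_le _ _
    _ ≤ δφ * (2 * (b + δ₀)) + 1 * (δ₀ + δ₀) := add_le_add h1 h2
    _ = 2 * δφ * (b + δ₀) + 2 * δ₀ := by ring

/-! ### At most two participants: sums of per-participant contributions -/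

/-- **A sum of contributions of (some of) the participants at a time of a hard-sphere trajectory has
at most two nonzero terms**: if `|f i| ≤ B` (`B ≥ 0`) then
`|∑ i, (if Participates … i ∧ P i then f i else 0)| ≤ 2B` (`sum_ite_participates_le_two`).
[cite: GST2013, §4.1] -/
theorem abs_sum_ite_participates_and_le {d X : Type*} [Fintype d] [TopologicalSpace X] {M : ℕ}
    {G : Geometry d X} {ε : ℝ} {γ : ℝ → Config M d X} (hγ : IsHardSphereTrajectory G ε M γ) (t : ℝ)
    (P : Fin M → Prop) [∀ i, Decidable (Participates G ε (γ t) i ∧ P i)] {f : Fin M → ℝ}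
    {B : ℝ} (hB : 0 ≤ B) (hf : ∀ i, |f i| ≤ B) :
    |∑ i, (if Participates G ε (γ t) i ∧ P i then f i else 0)| ≤ 2 * B := by
  classical
  have hterm : ∀ i, |(if Participates G ε (γ t) i ∧ P i then f i else 0)| ≤
      (if Participates G ε (γ t) i then (1 : ℝ) else 0) * B := by
    intro i
    by_cases hP : Participates G ε (γ t) i ∧ P i
    · rw [if_pos hP, if_pos hP.1, one_mul]
      exact hf i
    · rw [if_neg hP, abs_zero]
      exact mul_nonneg (by split_ifs <;> norm_num) hB
  calc |∑ i, (if Participates G ε (γ t) i ∧ P i then f i else 0)|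
      ≤ ∑ i, |(if Participates G ε (γ t) i ∧ P i then f i else 0)| := Finset.abs_sum_le_sum_abs _ _
    _ ≤ ∑ i, (if Participates G ε (γ t) i then (1 : ℝ) else 0) * B :=
        Finset.sum_le_sum fun i _ => hterm i
    _ ≤ 2 * B := by
        rw [← Finset.sum_mul]
        exact mul_le_mul_of_nonneg_right (sum_ite_participates_le_two hγ t) hB


/-! ### Threshold arithmetic for binned, clamped window estimates -/

/-- `(⌈kτ⌉₊ + 1)/τ ≤ k + 2` for `τ ≥ 1`, `k ≥ 0`. [folklore] -/
theorem natCeil_add_one_div_le {k τ : ℝ} (hk : 0 ≤ k) (hτ : 1 ≤ τ) :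
    ((⌈k * τ⌉₊ : ℝ) + 1) / τ ≤ k + 2 := by
  have hτ0 : 0 < τ := lt_of_lt_of_le one_pos hτ
  rw [div_le_iff₀ hτ0]
  have h1 : (⌈k * τ⌉₊ : ℝ) < k * τ + 1 := Nat.ceil_lt_add_one (by positivity)
  nlinarith

/-- **The deterministic budget of the binned clamped jump process.**  With `A = (|p|+1)c`, meshes
`δφ, δ₀ ≤ r₀ ≤ 1`, `A(k+2)·r₀(2(b+1)+2) ≤ δ/3`, and a window `τ ≥ max(1, 6Ab/δ)`:
`|p| c (2b + (⌈kτ⌉₊+1)(2δφ(b+δ₀)+2δ₀))/τ ≤ 2δ/3`. [folklore] -/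
theorem clampedJump_deterministic_budget_le {p c b k δ δφ δ₀ r₀ τ : ℝ} (hc : 0 < c) (hb : 0 < b)
    (hk : 0 < k) (hδ : 0 < δ) (hδφ : 0 < δφ) (hδφr : δφ ≤ r₀) (hδ₀ : 0 < δ₀) (hδ₀r : δ₀ ≤ r₀)
    (hr1 : r₀ ≤ 1) (hr : (|p| + 1) * c * (k + 2) * (r₀ * (2 * (b + 1) + 2)) ≤ δ / 3)
    (hτ1 : 1 ≤ τ) (hτ : 6 * ((|p| + 1) * c) * b / δ ≤ τ) :
    |p| * c * (2 * b + ((⌈k * τ⌉₊ : ℝ) + 1) * (2 * δφ * (b + δ₀) + 2 * δ₀)) / τ ≤ 2 * δ / 3 := by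
  have hτ0 : 0 < τ := lt_of_lt_of_le one_pos hτ1
  set A := (|p| + 1) * c with hA
  have hA0 : 0 < A := by rw [hA]; positivity
  have hpA : |p| * c ≤ A := by rw [hA]; nlinarith [abs_nonneg p]
  set e := 2 * δφ * (b + δ₀) + 2 * δ₀ with he
  have he0 : 0 ≤ e := by rw [he]; positivity
  have her : e ≤ r₀ * (2 * (b + 1) + 2) := by
    rw [he]
    have h1 : δφ * (b + δ₀) ≤ r₀ * (b + 1) :=
      mul_le_mul hδφr (by linarith) (by positivity) (hδφ.le.trans hδφr)
    nlinarith
  have h1 : A * (2 * b) / τ ≤ δ / 3 := by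
    rw [div_le_iff₀ hτ0]
    have : 6 * A * b / δ * (δ / 3) = A * (2 * b) := by field_simp; ring
    calc A * (2 * b) = 6 * A * b / δ * (δ / 3) := this.symm
      _ ≤ τ * (δ / 3) := mul_le_mul_of_nonneg_right hτ (by positivity)
      _ = δ / 3 * τ := mul_comm _ _
  have h2 : A * (((⌈k * τ⌉₊ : ℝ) + 1) * e) / τ ≤ δ / 3 := by
    have hK := natCeil_add_one_div_le hk.le hτ1
    calc A * (((⌈k * τ⌉₊ : ℝ) + 1) * e) / τ = A * ((((⌈k * τ⌉₊ : ℝ) + 1) / τ) * e) := by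
          field_simp
      _ ≤ A * ((k + 2) * e) :=
          mul_le_mul_of_nonneg_left (mul_le_mul_of_nonneg_right hK he0) hA0.le
      _ ≤ A * ((k + 2) * (r₀ * (2 * (b + 1) + 2))) :=
          mul_le_mul_of_nonneg_left (mul_le_mul_of_nonneg_left her (by positivity)) hA0.le
      _ = A * (k + 2) * (r₀ * (2 * (b + 1) + 2)) := by ring
      _ ≤ δ / 3 := hr
  calc |p| * c * (2 * b + ((⌈k * τ⌉₊ : ℝ) + 1) * e) / τ
      ≤ A * (2 * b + ((⌈k * τ⌉₊ : ℝ) + 1) * e) / τ := by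
        refine div_le_div_of_nonneg_right (mul_le_mul_of_nonneg_right hpA ?_) hτ0.le
        positivity
    _ = A * (2 * b) / τ + A * (((⌈k * τ⌉₊ : ℝ) + 1) * e) / τ := by ring
    _ ≤ δ / 3 + δ / 3 := add_le_add h1 h2
    _ = 2 * δ / 3 := by ring

/-- With at least two particles (`N ≠ 0`) and reduced diameter `σ ≤ 1/2` the diameter
`σ(N+1)^{-1/3}` is below `1/2` (the regularity threshold of the torus geometry). [folklore] -/
theorem hsDiameter_lt_half_of_ne_zero {σ : ℝ} (hσ : 0 < σ) (hσ2 : σ ≤ 2⁻¹) {N : ℕ} (hN : N ≠ 0) :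
    hsDiameter σ N < 2⁻¹ := by
  unfold hsDiameter
  have hlt : ((N + 1 : ℕ) : ℝ) ^ (-(1 / 3 : ℝ)) < 1 := by
    refine Real.rpow_lt_one_of_one_lt_of_neg ?_ (by norm_num)
    have : (2 : ℝ) ≤ ((N + 1 : ℕ) : ℝ) := by
      exact_mod_cast Nat.succ_le_succ (Nat.one_le_iff_ne_zero.2 hN)
    linarith
  have := mul_lt_mul_of_pos_left hlt hσ
  linarith

/-! ### Pressure domination by a one-body window average -/

/-- **Exponential moments dominated through a one-body window average.**  Under the flow-invariant
homogeneous Gibbs law `G_N` (`hstat`), if an observable `A` satisfies on the good set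
`A(z) ≤ α + w⁻¹∫₀ʷ Σᵢ q(Φ_s z i) ds` for a continuous one-body `q` with
`∫⁻ exp(q(x,v)) N(u,θ)(dv) ≤ C`, then `∫⁻ exp(A) dG_N ≤ exp(α) · C^{N+1}`
(`lintegral_exp_windowAvg_sum_localGibbsLaw_const_le`; the good set is `G_N`-conull). [folklore] -/
theorem lintegral_exp_le_of_le_windowAvg_sum_localGibbsLaw_const {a θ : ℝ} (ha : 0 < a) (hθ : 0 < θ)
    (u : V3) {σ : ℝ} (hσ2 : σ ≤ 1 / 2) (N : ℕ)
    (Φ : HardSphereFlow (Torus.geometry (Fin 3)) (hsDiameter σ N) (N + 1))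
    (hstat : ∀ t : ℝ, MeasurePreserving (Φ.flow t)
      (localGibbsLaw σ (fun _ => a) (fun _ => u) (fun _ => θ) N Φ)
      (localGibbsLaw σ (fun _ => a) (fun _ => u) (fun _ => θ) N Φ))
    {q : T3 × V3 → ℝ} (hq : Continuous q) {C : ℝ≥0∞}
    (hC : ∀ x : T3, ∫⁻ v, ENNReal.ofReal (Real.exp (q (x, v))) ∂(gaussMeasure u θ) ≤ C)
    {w : ℝ} (hw : 0 < w) {A : Config (N + 1) (Fin 3) T3 → ℝ} {α : ℝ}
    (hA : ∀ z ∈ Φ.good, A z ≤ α + w⁻¹ * ∫ s in (0 : ℝ)..w, ∑ i, q (Φ.flow s z i)) :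
    ∫⁻ z, ENNReal.ofReal (Real.exp (A z))
        ∂(localGibbsLaw σ (fun _ => a) (fun _ => u) (fun _ => θ) N Φ) ≤
      ENNReal.ofReal (Real.exp α) * C ^ (N + 1) := by
  set P := localGibbsLaw σ (fun _ => a) (fun _ => u) (fun _ => θ) N Φ with hP
  have hgood : ∀ᵐ z ∂P, z ∈ Φ.good := ae_mem_good_localGibbsLaw σ _ _ _ N Φ
  calc ∫⁻ z, ENNReal.ofReal (Real.exp (A z)) ∂P
      ≤ ∫⁻ z, ENNReal.ofReal (Real.exp α) *
          ENNReal.ofReal (Real.exp (w⁻¹ * ∫ s in (0 : ℝ)..w, ∑ i, q (Φ.flow s z i))) ∂P := by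
        refine lintegral_mono_ae ?_
        filter_upwards [hgood] with z hz
        rw [← ENNReal.ofReal_mul (Real.exp_nonneg _), ← Real.exp_add]
        exact ENNReal.ofReal_le_ofReal (Real.exp_le_exp.2 (hA z hz))
    _ = ENNReal.ofReal (Real.exp α) *
          ∫⁻ z, ENNReal.ofReal (Real.exp (w⁻¹ * ∫ s in (0 : ℝ)..w, ∑ i, q (Φ.flow s z i))) ∂P :=
        lintegral_const_mul' _ _ ENNReal.ofReal_ne_top
    _ ≤ ENNReal.ofReal (Real.exp α) * C ^ (N + 1) :=
        mul_le_mul' le_rfl (lintegral_exp_windowAvg_sum_localGibbsLaw_const_le ha hθ u hσ2 N Φ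
          hstat hq hC hw)

end Literature.MathematicalPhysics.KineticTheory

end
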